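import Summits.BirchSwinnertonDyer.BirchSwinnertonDyer.Theorems.ByReductionTypeAtTwoTowerFiltrationLayer
import HarnessLib

/-!
# The MODULE-FILTRATION certificate, part 3: `O1.TowerGapAtTwo W` from ONE layer's `2`-Selmer group with its
# `Gal(ℚ_n/ℚ)`-module structure, any window `[m, m+k] ⊆ [0, 2ⁿ]` (route ByReductionTypeAtTwo, crux
# `MultUpperHalfAtTwo`, item stmt-BirchSwinnertonDyer-19922; seat bsd-2adic-mult-2 GEN 9, part 3 of 3)

HONEST FRAMING (cell `bsd-2adic`, run/shared/lean/pub/bsd-2adic/, HUMAN RULINGS D-0036/D-0054/D-0074): THEOREMS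
ONLY; nothing asserted; no definition; no new named fact; closes nothing by itself; BSD is not proved by any
of this. PARTITION: X5@2 mult (K4ᵐ, B1·O1) × p = 2 — types-the-object-of (a sharper per-class certificate
format for item 19922 AT the class); closes none. bears_on: K4 (route-BirchSwinnertonDyer-ByReductionTypeAtTwo
item 19922).

THE LEVER («σ-lever», seat bsd-2adic-mult-2 GEN 9). Tower-1's chain (`…TowerLayerDuality` → `…TowerLayerLocal`
→ `…TowerLayerGap`) reads the TOWER-GAP certificate `O1.TowerGapAtTwo W` — ONE gap
`#X/(2,T^{m+k})X < 2^k · #X/(2,T^m)X` (T10: then `X` is torsion and `μ = 0`) — off TWO layers at `m = 2^j`,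
`m + k = 2^{j'}`. But T10 allows ANY `m, k`, and for `m ≤ pⁿ` the quotient `X/(p,T^m)X` is ALSO visible at
layer `n`: it is dual to the `p`-torsion classes of `Sel_∞` killed by `(conj_γ − 1)^m`, and those are exactly
the classes of `A_n[p]` killed by `(σ − 1)^m`, `σ = γ|_{K_n}` (`h_n` is injective and `conj`-equivariant when
`E(K)[p] = 0`). So ONE descent at layer `n` recording the action of a generator `σ` of `Gal(K_n/K)` on
`Sel_p(E/K_n)` gives `s(m) = dim_𝔽_p {z ∈ Sel_n[p] : (σ−1)^m z = 0}` for all `m ≤ pⁿ`, and the gap is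
certified as `s(m+k) − s(m) + Σ_n < k` on ANY window `[m, m+k] ⊆ [0, pⁿ]` instead of
`d_{j'} − d_j + Σ_{j'} < p^{j'} − p^j`. In terms of the Jordan blocks `b₁ ≥ b₂ ≥ …` of `T` on `X/pX`
(`Σ bᵢ = λ` when `μ = 0` and `X` has no finite submodule): at `p = 2`, layer `3`, the two-layer certificate
`(0, 3)` needs `λ + Σ₃ ≤ 8`, the window `(7 − Σ₃, Σ₃ + 1)` needs only `b₁ + Σ₃ ≤ 7`.

This part (`p = 2` over `ℚ`, odd torsion order):
* **`towerGapAtTwo_of_filtration_localKernelBounds`** — the gap from the window `(m, k)`, `m + k ≤ 2ⁿ`, at ONE layer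
  `n`: certificates `2^a ≤ #{z ∈ Sel_n[2] : ν^[m] z = 0}`, `#{z ∈ Sel_n[2] : ν^[m+k] z = 0} ≤ 2^d` (`ν = conj_γ − id`,
  for every cyclotomic `κ` with topological generator `γ`), tower-1's local interface `(S, C, N, h0, hC, hN)` at
  level `n` verbatim, arithmetic `2^d · ∏ C_v^{N_v} < 2^{k + a}`;
* **`towerGapAtTwo_of_filtration_localKernelBounds_sharp`** — the same with tower-1's SHARP covers built in
  (`N_v = 1` over `2`, `2^{min(n, v₂(ℓ_v²−1)−3)}` at odd `v`): the exact interface of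
  `KatoHalfPinch.towerGapAtTwo_of_localKernelBounds_sharp` with the two layer counts replaced by two filtered
  counts at one layer and the exponent `2^{j'} − 2^j + a` by `k + a`. The doors of `…MultUpperHalfTowerCert`
  (numeric → nat → cert, constant at `2` a datum) carry over with that one change (next file).

WHAT IS DISPLAYED, NOT PROVED (in the doors): the same PRINT/MEMO binders as the two-layer doors; the CERTIFICATE
binders become the two filtered counts (engine: ENGINE A + the `S2| SIGMA` block of `sel2sigma.gp`, evidence tier).

References: R. Greenberg, LNM 1716 (1999), §1 p. 60 (`X/𝔪X` dual to `Sel[𝔪]`, the `Λ`-action through `Γ`),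
§3 pp. 85–90 (Lemmas 3.1–3.5); L. Washington, *Introduction to Cyclotomic Fields*, §13.1–13.2 (`ω_n`,
Lemma 13.16); J.-P. Serre, *Galois Cohomology*, I.§2.5.
-/
set_option autoImplicit false
-- the Theorems namespace of this sub repeats the summit name by design (D-0017 nested layout: Summit.<S>.<Sub>)
set_option linter.dupNamespace false

noncomputable section

open scoped Classical

open NumberField IsDedekindDomain WeierstrassCurve Literature.NumberTheory.EllipticCurves
  Literature.NumberTheory.EllipticCurves.IwasawaDual PowerSeries Summit.BirchSwinnertonDyer.Rank1Residual
  Summit.BirchSwinnertonDyer.Rank1Residual.X5.TowerGap Summit.BirchSwinnertonDyer.Rank1Residual.X5.O1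

universe u

namespace Summit.BirchSwinnertonDyer.BirchSwinnertonDyer.Theorems.TowerFiltration
/-! ## §4 `p = 2` over `ℚ`: the GAP certificate from ONE layer and a window `[m, m+k] ⊆ [0, 2ⁿ]` -/

section Curve

variable (W : WeierstrassCurve ℚ) [W.IsElliptic]

/-- **The GAP certificate from the `(σ−1)`-filtration of ONE layer, with EXPLICIT local error terms.**
`W/ℚ` with odd torsion order; a layer `n` and a window `m + k ≤ 2ⁿ`; certificates
`2^a ≤ #{z ∈ Sel_{2^∞}(E/ℚ_n)[2] : (conj_γ − id)^[m] z = 0}` and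
`#{z ∈ Sel_{2^∞}(E/ℚ_n)[2] : (conj_γ − id)^[m+k] z = 0} ≤ 2^d` for every cyclotomic `κ` with topological
generator `γ`; a finite set `S` of places with, at level `n`: `𝒦_{v,n}[2^∞] = 0` off `S` (`h0`),
`#𝒦_{v,n}[2] ≤ C_v` on `S` (`hC`), covering sets of size `≤ N_v` (`hN`); and the arithmetic
`2^d · ∏_{v ∈ S} C_v^{N_v} < 2^{k + a}`. Then `O1.TowerGapAtTwo W` with the window `(m, k)`:
`#X/(2,T^{m+k})X ≤ 2^d · ∏ C_v^{N_v} < 2^k · 2^a ≤ 2^k · #X/(2,T^m)X` (§2, §3). Tower-1's two-layer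
`towerGapAtTwo_of_localKernelBounds` is the window `(2^j, 2^{j'} − 2^j)` read at two layers.
[cite: GreenbergLNM1716, §1 p. 60 and §3 pp. 85–90 (Lemmas 3.3–3.5)] [cite: Washington1997, §13.2] -/
theorem towerGapAtTwo_of_filtration_localKernelBounds (htors : ¬ 2 ∣ W.torsionOrder) {n m k a d : ℕ}
    (hmk : m + k ≤ 2 ^ n) (S : Finset (HeightOneSpectrum (𝓞 ℚ))) (C N : HeightOneSpectrum (𝓞 ℚ) → ℕ)
    (hlow : ∀ (κ : ZpExtension ℚ 2) (γ : Field.absoluteGaloisGroup ℚ), κ.IsCyclotomic →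
      κ.IsTopGenerator γ →
        2 ^ a ≤ Nat.card {z : W.selmerLayer κ n // 2 • z = 0 ∧
          (⇑(W.conjH1 2 (κ.layerSubgroup n) γ -
            AddMonoidHom.id (W.subgroupH1 2 (κ.layerSubgroup n))))^[m]
            (z : W.subgroupH1 2 (κ.layerSubgroup n)) = 0})
    (hup : ∀ (κ : ZpExtension ℚ 2) (γ : Field.absoluteGaloisGroup ℚ), κ.IsCyclotomic →
      κ.IsTopGenerator γ →
        Nat.card {z : W.selmerLayer κ n // 2 • z = 0 ∧
          (⇑(W.conjH1 2 (κ.layerSubgroup n) γ -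
            AddMonoidHom.id (W.subgroupH1 2 (κ.layerSubgroup n))))^[m + k]
            (z : W.subgroupH1 2 (κ.layerSubgroup n)) = 0} ≤ 2 ^ d)
    (h0 : ∀ κ : ZpExtension ℚ 2, κ.IsCyclotomic →
      ∀ v ∉ S, W.localTowerKerPrimary κ (v.adicCompletion ℚ) n = ⊥)
    (hC : ∀ κ : ZpExtension ℚ 2, κ.IsCyclotomic → ∀ v ∈ S,
      Finite {x : W.localTowerKerPrimary κ (v.adicCompletion ℚ) n // 2 • x = 0} ∧
        Nat.card {x : W.localTowerKerPrimary κ (v.adicCompletion ℚ) n // 2 • x = 0} ≤ C v)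
    (hN : ∀ κ : ZpExtension ℚ 2, κ.IsCyclotomic → ∀ v ∈ S,
      ∃ R : Finset (Field.absoluteGaloisGroup ℚ), R.card ≤ N v ∧
        ∀ σ : Field.absoluteGaloisGroup ℚ, ∃ ρ ∈ R,
          ∃ δ : Field.absoluteGaloisGroup (v.adicCompletion ℚ), ∃ τ ∈ κ.layerSubgroup n,
            σ = resGal (K := ℚ) (v.adicCompletion ℚ) δ * ρ * τ)
    (harith : 2 ^ d * ∏ v ∈ S, C v ^ N v < 2 ^ (k + a)) : TowerGapAtTwo W := by
  intro κ γ hκ hγ _ D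
  haveI : Module.Finite (IwasawaAlgebra 2) D.X := D.module_finite_holds hγ
  have hK := Iwasawa.forall_smul_eq_zero_imp_of_not_dvd_torsionOrder W htors
  have hm : m ≤ 2 ^ n := le_trans (Nat.le_add_right m k) hmk
  choose! R hRcard hRcov using hN κ hκ
  -- `1 ≤ C v` on `S`
  have hCpos : ∀ v ∈ S, 1 ≤ C v := fun v hv ↦ by
    haveI := (hC κ hκ v hv).1
    haveI : Nonempty {x : W.localTowerKerPrimary κ (v.adicCompletion ℚ) n // 2 • x = 0} :=
      ⟨⟨0, smul_zero _⟩⟩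
    exact Nat.succ_le_of_lt (lt_of_lt_of_le Nat.card_pos (hC κ hκ v hv).2)
  -- finiteness of the filtered pieces of `A_n[2]` and `Sel_n[2]` (they inject into `A_n[2]`, `Sel_n[2]`)
  haveI := TowerLayer.finite_layerClasses W κ D hK n
  haveI := (KatoHalfPinch.finite_and_natCard_selmerLayer_pTorsion_le W κ D hK n).1
  have hfinA : ∀ m' : ℕ, Finite {z : W.selmerInftyPreimage κ n // 2 • z = 0 ∧
      (⇑(W.conjH1 2 (κ.layerSubgroup n) γ -
          AddMonoidHom.id (W.subgroupH1 2 (κ.layerSubgroup n))))^[m']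
        (z : W.subgroupH1 2 (κ.layerSubgroup n)) = 0} := fun m' ↦
    Finite.of_injective (fun z ↦ (⟨z.1, z.2.1⟩ : {z : W.selmerInftyPreimage κ n // 2 • z = 0}))
      fun z z' h ↦ Subtype.ext (congrArg (fun w : {z : W.selmerInftyPreimage κ n // 2 • z = 0} ↦ w.1) h)
  have hfinS : ∀ m' : ℕ, Finite {z : W.selmerLayer κ n // 2 • z = 0 ∧
      (⇑(W.conjH1 2 (κ.layerSubgroup n) γ -
          AddMonoidHom.id (W.subgroupH1 2 (κ.layerSubgroup n))))^[m']
        (z : W.subgroupH1 2 (κ.layerSubgroup n)) = 0} := fun m' ↦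
    Finite.of_injective (fun z ↦ (⟨z.1, z.2.1⟩ : {z : W.selmerLayer κ n // 2 • z = 0}))
      fun z z' h ↦ Subtype.ext (congrArg (fun w : {z : W.selmerLayer κ n // 2 • z = 0} ↦ w.1) h)
  refine ⟨m, k, ?_⟩
  calc Nat.card (D.X ⧸ (towerIdeal 2 (m + k) • ⊤ : Submodule (IwasawaAlgebra 2) D.X))
      = Nat.card {z : W.selmerInftyPreimage κ n // 2 • z = 0 ∧
          (⇑(W.conjH1 2 (κ.layerSubgroup n) γ -
            AddMonoidHom.id (W.subgroupH1 2 (κ.layerSubgroup n))))^[m + k]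
            (z : W.subgroupH1 2 (κ.layerSubgroup n)) = 0} :=
        natCard_quotient_towerIdeal_eq_natCard_layerFiltration W κ D hγ hK n hmk
    _ ≤ Nat.card {z : W.selmerLayer κ n // 2 • z = 0 ∧
          (⇑(W.conjH1 2 (κ.layerSubgroup n) γ -
            AddMonoidHom.id (W.subgroupH1 2 (κ.layerSubgroup n))))^[m + k]
            (z : W.subgroupH1 2 (κ.layerSubgroup n)) = 0} * ∏ v ∈ S, C v ^ (R v).card :=
        natCard_layerFiltration_le_of_localKernelBounds W κ S C R (h0 κ hκ) (hC κ hκ) hRcov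
          (hfinS _)
    _ ≤ 2 ^ d * ∏ v ∈ S, C v ^ N v :=
        Nat.mul_le_mul (hup κ γ hκ hγ) (Finset.prod_le_prod (fun v _ ↦ Nat.zero_le _)
          fun v hv ↦ Nat.pow_le_pow_right (hCpos v hv) (hRcard v hv))
    _ < 2 ^ (k + a) := harith
    _ = 2 ^ k * 2 ^ a := by rw [pow_add]
    _ ≤ 2 ^ k * Nat.card {z : W.selmerLayer κ n // 2 • z = 0 ∧
          (⇑(W.conjH1 2 (κ.layerSubgroup n) γ -
            AddMonoidHom.id (W.subgroupH1 2 (κ.layerSubgroup n))))^[m]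
            (z : W.subgroupH1 2 (κ.layerSubgroup n)) = 0} :=
        Nat.mul_le_mul_left _ (hlow κ γ hκ hγ)
    _ ≤ 2 ^ k * Nat.card {z : W.selmerInftyPreimage κ n // 2 • z = 0 ∧
          (⇑(W.conjH1 2 (κ.layerSubgroup n) γ -
            AddMonoidHom.id (W.subgroupH1 2 (κ.layerSubgroup n))))^[m]
            (z : W.subgroupH1 2 (κ.layerSubgroup n)) = 0} :=
        Nat.mul_le_mul_left _ (natCard_selmerFiltration_le W κ (hfinA m))
    _ = 2 ^ k * Nat.card (D.X ⧸ (towerIdeal 2 m • ⊤ : Submodule (IwasawaAlgebra 2) D.X)) := by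
        rw [natCard_quotient_towerIdeal_eq_natCard_layerFiltration W κ D hγ hK n hm]

/-- **The same, SHARP covers built in** (`N_v = 1` at the prime over `2` — it is totally ramified in the
cyclotomic tower, `TowerLayer.cover_singleton_at_p` —, `N_v = 2^{min(n, v₂(ℓ_v² − 1) − 3)}` at an odd
`v`, `TowerLayer.exists_cover_card_le_odd_two`): the exact interface of tower-1's
`towerGapAtTwo_of_localKernelBounds_sharp` with the two layer counts replaced by the two filtered counts
at ONE layer and the exponent `2^{j'} − 2^j + a` by `k + a`. [cite: GreenbergLNM1716, §3 pp. 85–90]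
[cite: Washington1997, §13.1] -/
theorem towerGapAtTwo_of_filtration_localKernelBounds_sharp (htors : ¬ 2 ∣ W.torsionOrder)
    {n m k a d : ℕ} (hmk : m + k ≤ 2 ^ n) (S : Finset (HeightOneSpectrum (𝓞 ℚ)))
    (C : HeightOneSpectrum (𝓞 ℚ) → ℕ)
    (hlow : ∀ (κ : ZpExtension ℚ 2) (γ : Field.absoluteGaloisGroup ℚ), κ.IsCyclotomic →
      κ.IsTopGenerator γ →
        2 ^ a ≤ Nat.card {z : W.selmerLayer κ n // 2 • z = 0 ∧
          (⇑(W.conjH1 2 (κ.layerSubgroup n) γ -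
            AddMonoidHom.id (W.subgroupH1 2 (κ.layerSubgroup n))))^[m]
            (z : W.subgroupH1 2 (κ.layerSubgroup n)) = 0})
    (hup : ∀ (κ : ZpExtension ℚ 2) (γ : Field.absoluteGaloisGroup ℚ), κ.IsCyclotomic →
      κ.IsTopGenerator γ →
        Nat.card {z : W.selmerLayer κ n // 2 • z = 0 ∧
          (⇑(W.conjH1 2 (κ.layerSubgroup n) γ -
            AddMonoidHom.id (W.subgroupH1 2 (κ.layerSubgroup n))))^[m + k]
            (z : W.subgroupH1 2 (κ.layerSubgroup n)) = 0} ≤ 2 ^ d)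
    (h0 : ∀ κ : ZpExtension ℚ 2, κ.IsCyclotomic →
      ∀ v ∉ S, W.localTowerKerPrimary κ (v.adicCompletion ℚ) n = ⊥)
    (hC : ∀ κ : ZpExtension ℚ 2, κ.IsCyclotomic → ∀ v ∈ S,
      Finite {x : W.localTowerKerPrimary κ (v.adicCompletion ℚ) n // 2 • x = 0} ∧
        Nat.card {x : W.localTowerKerPrimary κ (v.adicCompletion ℚ) n // 2 • x = 0} ≤ C v)
    (harith : 2 ^ d * ∏ v ∈ S, C v ^
        (if ((2 : ℕ) : 𝓞 ℚ) ∈ v.asIdeal then 1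
          else 2 ^ min n (padicValNat 2 (Rat.HeightOneSpectrum.natGenerator v ^ 2 - 1) - 3)) <
      2 ^ (k + a)) : TowerGapAtTwo W := by
  refine towerGapAtTwo_of_filtration_localKernelBounds W htors hmk S C
    (fun v ↦ if ((2 : ℕ) : 𝓞 ℚ) ∈ v.asIdeal then 1
      else 2 ^ min n (padicValNat 2 (Rat.HeightOneSpectrum.natGenerator v ^ 2 - 1) - 3))
    hlow hup h0 hC (fun κ hκ v _ ↦ ?_) harith
  by_cases h2 : ((2 : ℕ) : 𝓞 ℚ) ∈ v.asIdeal
  · refine ⟨{1}, by rw [if_pos h2, Finset.card_singleton], ?_⟩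
    exact TowerLayer.cover_singleton_at_p κ hκ v h2 n
  · rw [if_neg h2]
    exact TowerLayer.exists_cover_card_le_odd_two hκ v h2 n

end Curve

end Summit.BirchSwinnertonDyer.BirchSwinnertonDyer.Theorems.TowerFiltration

end
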